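import Summits.BirchSwinnertonDyer.Rank1Residual.AdditivePotMult.PotMultBudgetRankZeroEnds
import Summits.BirchSwinnertonDyer.Rank1Residual.Additive.CongruentLambdaShiftOfEPW
import HarnessLib

/-!
# X4(M) ∧ surj(p) ∧ `r_an = 0`, EVERY odd `p` (`p = 3` included): the budget from a CONGRUENT PARTNER
# via the CITED Emerton–Pollack–Weston algebraic transfer — the partner needs NO certificate, only
# RANK (cell `b2b-bsdres`, team n1011, seat p07 (gen 3), row T-E3dM FILE 3 = the (M) twin of
# n1011-p10's Route-G F4; sequel of `PotMultBudgetRankZeroEnds.lean`)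

HONEST FRAMING (cell `b2b-bsdres`, run/shared/lean/b2b/bsd-rank1-residual/, verbatim in every
file): the goal of the cell is to DELETE the COMBINATION-SHAPED residual classes of the
Birch–Swinnerton-Dyer formula for ALL analytic-rank `≤ 1` elliptic curves over `ℚ` — "full BSD
formula for every rank `≤ 1` curve in class `C`" assembled STRICTLY from published theorems — so
that the rank-`≤ 1` remainder becomes exactly the CONSTRUCTION-SHAPED classes, which are TYPED
(missing-input `Prop`s), NOT attempted. This is not "finishing BSD". Team n1011 (RESIDUAL-MAP §I
N10 / N11 LOWER half on the (M) rows = X4(M) ∧ surj(p) ∧ `r_an = 0`, every odd `p`): research route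
on CONSTRUCTION-SHAPED items; labels and marks UNCHANGED; nothing booked — every statement below is
PER PAIR modulo the named facts AND per-pair inputs outside the kernel (the census record =
CERTIFICATE-EVIDENCE; the two ramified ordinary lines, the line-respecting `E[p] ≅ E₁[p]` and the
finite set `Σ₀` = per-pair data, cc-typer-1's typer backlog TB-ROL); booking = director, per pair,
after countersign. NO Literature fact minted; NO definition. Named facts as HYPOTHESES only: `hK`
(Kato 2004 Thm. 17.4 (3) half-eigenspace reading
`Wuthrich2014.kato_halfEigenCharIdeal_dvd_cyclotomicPrime_of_surjective`), `hEPW` (Emerton–Pollack–Weston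
2006 Thms. 3.3.2 / 3.3.3 (2) + Lemma 5.1.5 on a ramified branch,
`EmertonPollackWeston2006.muLambdaAlg_transfer_of_torsionIso_potOrd` — by n1011-lit's C-audit
(LIT-INPUTS-P3 v12 §20, N1) its ramified ordinary line covers the potentially MULTIPLICATIVE case
`θ` quadratic, `a = (p−1)/2` with the same print, so NO second EPW fact is needed for (M) pairs),
`hDel`/`hDelX` (Delbourgo 1998 Prop. 4), `hPal` (Pal 2012 Thm. 3.2, even branch only), `hGZK`, `hmod`,
`hmodD`. Debt 0.

## What and why

n1011-p10's Route G closes the main conjecture at `E` from Kato integrality + ONE unit coefficient at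
index `b` + the typed LOWER input `BudgetLeLambdaAt p E b`. `PotMultCongruentPartnerMainConjecture` §0
produced the budget from X1's typed schema `CongruentLambdaShift` + a partner with `μ = 0 ∧ r₁ ≤ λ`.
Here the schema AND the partner's `μ = 0` come from the cited EPW transfer (cc-typer-1's
`congruentLambdaShift_of_epw` / `mu_eq_zero_of_epw` pattern, read directly off the fact):

* §1 `budgetLeLambdaAt_of_epw_of_partnerRank` (reduction-agnostic in the statement; the lines force
  both curves additive potentially ordinary-or-multiplicative at `p`): `hEPW` + ramified ordinary lines `L` at
  `E`, `L₁` at `E₁` + `E[p]` irreducible + a line-respecting `Γ_ℚ`-isomorphism `E[p] ≃ E₁[p]` +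
  `Σ₀ ∌ p` outside which both curves are good + a partner whose finitely generated cyclotomic dual
  data are TORSION with `μ = 0 ⟹ r₁ ≤ λ` ⟹ `BudgetLeLambdaAt p E b` for every
  `b ≤ r₁ + Σ_{w∈Σ₀} (δ(E₁,w) − δ(E,w))` (`μ(X(E)) = 0` is TRANSFERRED to the partner by EPW 3.3.2, so
  the partner needs no unit coefficient of its own).
* §2 `ClassX4M.isTorsion_and_le_lambdaInvariant_of_katoHalf`: an (M) ∧ surj(p) PARTNER supplies that
  input from Kato's divisibility ALONE (torsion: the brick; `μ = 0 ⟹ rank E₁(ℚ) ≤ λ`: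
  Greenberg–Vatsal (1) ⟺ (2) + `T^{rank} ∣ char`), for every `r₁ ≤ rank E₁(ℚ)`.
* §3 the rank-`0` ENDS: `ClassX4M.bsdp_rankZero_of_surj_of_katoHalf_of_firstUnitIndex_of_epw` (any
  partner with the §1 input) and the fully composed (M)–(M) pair theorem
  `ClassX4M.bsdp_rankZero_of_surj_of_katoHalf_of_firstUnitIndex_of_epw_of_multPartner`: per (M)
  congruent pair the residual inputs are EXACTLY the record at `E` (ONE unit coefficient at index
  `b`), the two line data, the line-respecting isomorphism, `Σ₀`, and a partner of RANK `≥ r₁` with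
  `b ≤ r₁ + Σ (δ₁ − δ)` — the (M) twin of n1011-p10's F4 sentence.

What is NOT claimed: the line data / isomorphism / `Σ₀` bookkeeping (per pair, typer backlog TB-ROL:
nothing in the tree constructs an `IsRamifiedOrdinaryLine` yet); rows without a congruent partner of
enough rank; non-surjective rows (O8); `r_an = 1`; `p = 2`. X4(M) stays CONSTRUCTION-SHAPED; nothing
booked; no number is quoted as closing anything.

References: M. Emerton, R. Pollack, T. Weston, Invent. Math. 163 (2006) Thms. 3.3.2, 3.3.3, Lemma
5.1.5 [EmertonPollackWeston2006]; R. Greenberg, V. Vatsal, Invent. Math. 142 (2000) §2 Prop. (2.4),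
p. 2 [GreenbergVatsal2000]; K. Kato, Astérisque 295 (2004) Thm. 17.4 [Kato2004Asterisque];
R. Greenberg, LNM 1716 (1999) §3 Lemma 3.1 [GreenbergLNM1716]; D. Delbourgo, Compositio Math. 113
(1998) Prop. 4 [Delbourgo1998]; A. Pal, Thm. 3.2 [Pal2012]; R. L. Miller, LMS J. Comput. Math. 14
(2011) Def. 1.1 [Miller2011LMS].
-/

set_option autoImplicit false

noncomputable section

open scoped Classical MatrixGroups ModularForm NumberField

namespace Summit.BirchSwinnertonDyer.Rank1Residual.AdditivePotMult

open CongruenceSubgroup WeierstrassCurve NumberField IsDedekindDomain Field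
  Literature.NumberTheory.EllipticCurves
  Literature.NumberTheory.EllipticCurves.ModularForms
  Literature.NumberTheory.EllipticCurves.Rank1Residual
  Literature.NumberTheory.EllipticCurves.Rank1Residual.Typed
  Literature.NumberTheory.EllipticCurves.GreenbergSelmer
  Literature.NumberTheory.EllipticCurves.GreenbergVatsal2000
  Literature.NumberTheory.EllipticCurves.EmertonPollackWeston2006
  Literature.NumberTheory.GaloisRepresentations
  Summit.BirchSwinnertonDyer.Rank1Residual.Additive
  Summit.BirchSwinnertonDyer.Rank1Residual.Additive.CensusQ6

/-! ### §1 The budget from the cited EPW transfer: the partner needs torsion and rank, no certificate -/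

section Budget

variable {W W₁ : WeierstrassCurve ℚ} [W.IsElliptic] [W.IsGloballyMinimal] [W₁.IsElliptic]
  [W₁.IsGloballyMinimal] {p : ℕ} [hp : Fact p.Prime]

/-- **The budget from a congruent partner via the CITED EPW algebraic transfer.** Hypotheses: the named
fact `hEPW`; `p ≠ 2`; the place `v ∋ p`; ramified ordinary lines `L` at `E = W` and `L₁` at the partner
`E₁ = W₁` (`IsRamifiedOrdinaryLine`: additive, potentially ordinary OR potentially multiplicative);
`E[p]` irreducible; a `Γ_ℚ`-equivariant `E[p] ≃ E₁[p]` carrying `C[p]` to `C₁[p]`; `Σ₀ ∌ p` outside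
which both curves are good; and a partner whose finitely generated cyclotomic dual data `D₁` are
TORSION with `μ(X₁) = 0 ⟹ r₁ ≤ λ(X₁)`. Then n1011-p10's `BudgetLeLambdaAt p W b` for every
`b ≤ r₁ + Σ_{w∈Σ₀} (δ(E₁,w) − δ(E,w))`: given `D` torsion with `μ(X) = 0`, EPW 3.3.2 transfers `μ = 0`
to `D₁` and EPW 3.3.3 (2) + Lemma 5.1.5 give `λ(X) + Σ δ(E) = λ(X₁) + Σ δ(E₁)`.
[cite: EmertonPollackWeston2006, Thm. 3.3.2, Thm. 3.3.3 (2) (arXiv:math/0404484 p. 19) and Lemma 5.1.5 (p. 30)]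
[cite: GreenbergVatsal2000, §2 Prop. (2.4) (p. 22) (δ = s_ℓ d_ℓ)] -/
theorem budgetLeLambdaAt_of_epw_of_partnerRank (hEPW : muLambdaAlg_transfer_of_torsionIso_potOrd)
    (hp2 : p ≠ 2)
    {v : HeightOneSpectrum (𝓞 ℚ)} (hv : ((p : ℕ) : 𝓞 ℚ) ∈ v.asIdeal)
    {L : LocalDatum ℚ (W.geomPrimaryTorsion p) v} {L₁ : LocalDatum ℚ (W₁.geomPrimaryTorsion p) v}
    (hL : IsRamifiedOrdinaryLine W p L) (hL₁ : IsRamifiedOrdinaryLine W₁ p L₁)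
    (hirr : W.HasIrreducibleModPGaloisRep p)
    (hiso : ∃ e : geomTorsion W (p : ℤ) ≃+ geomTorsion W₁ (p : ℤ),
      (∀ (σ : absoluteGaloisGroup ℚ) (P : geomTorsion W (p : ℤ)), e (σ • P) = σ • e P) ∧
      (∀ P : geomTorsion W (p : ℤ),
        AddSubgroup.inclusion (geomTorsion_le_geomPrimaryTorsion W p) P ∈ L.plus ↔
          AddSubgroup.inclusion (geomTorsion_le_geomPrimaryTorsion W₁ p) (e P) ∈ L₁.plus))
    (S₀ : Finset (HeightOneSpectrum (𝓞 ℚ))) (hS₀ : ∀ w ∈ S₀, ((p : ℕ) : 𝓞 ℚ) ∉ w.asIdeal)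
    (hS : ∀ w : HeightOneSpectrum (𝓞 ℚ), w ∉ S₀ → ((p : ℕ) : 𝓞 ℚ) ∉ w.asIdeal →
      W.HasGoodReductionAt w)
    (hS₁ : ∀ w : HeightOneSpectrum (𝓞 ℚ), w ∉ S₀ → ((p : ℕ) : 𝓞 ℚ) ∉ w.asIdeal →
      W₁.HasGoodReductionAt w)
    {r₁ : ℕ}
    (h₁ : ∀ {κ : ZpExtension ℚ p} {γ : absoluteGaloisGroup ℚ},
      κ.IsCyclotomic → κ.IsTopGenerator γ → IsCyclotomicVariable p γ →
      ∀ (D₁ : W₁.SelmerDualData κ γ) [Module.Finite (IwasawaAlgebra p) D₁.X],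
        D₁.IsTorsion ∧ (D₁.mu = 0 → r₁ ≤ lambdaInvariant p D₁.X))
    {b : ℕ} (hb : (b : ℤ) ≤ r₁ + ∑ w ∈ S₀, ((delta W₁ p w : ℤ) - (delta W p w : ℤ))) :
    BudgetLeLambdaAt p W b := by
  intro κ γ hκ hγ hγ' D _ hX hmu
  obtain ⟨D₁⟩ := W₁.nonempty_selmerDualData_holds κ γ hγ
  haveI : Module.Finite (IwasawaAlgebra p) D₁.X := D₁.module_finite_holds hγ
  obtain ⟨hX₁, hr₁⟩ := h₁ hκ hγ hγ' D₁
  obtain ⟨hmu₁, hlam⟩ :=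
    hEPW W W₁ p hp2 v hv L L₁ hL hL₁ hirr hiso S₀ hS₀ hS hS₁ κ γ hκ hγ hγ' D D₁ hX hX₁ hmu
  have hr : (r₁ : ℤ) ≤ lambdaInvariant p D₁.X := by exact_mod_cast hr₁ hmu₁
  have h' : ((lambdaInvariant p D.X + ∑ w ∈ S₀, delta W p w : ℕ) : ℤ) =
      ((lambdaInvariant p D₁.X + ∑ w ∈ S₀, delta W₁ p w : ℕ) : ℤ) := by rw [hlam]
  push_cast at h'
  rw [Finset.sum_sub_distrib] at hb
  have hle : (b : ℤ) ≤ lambdaInvariant p D.X := by linarith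
  exact_mod_cast hle

omit [W₁.IsElliptic] [W₁.IsGloballyMinimal] in
/-- **The partner-side input WITH the partner's `μ = 0` known** (e.g. from its own unit coefficient,
`ClassX4M.partnerInput_of_katoHalf_of_unitCoeffCert[_odd]`, or n1011-p10's `partnerPackage`) is a
special case of the §1 shape. -/
theorem partnerInputEPW_of_partnerInput {r₁ : ℕ}
    (h₁ : ∀ {κ : ZpExtension ℚ p} {γ : absoluteGaloisGroup ℚ},
      κ.IsCyclotomic → κ.IsTopGenerator γ → IsCyclotomicVariable p γ →
      ∀ (D₁ : W₁.SelmerDualData κ γ) [Module.Finite (IwasawaAlgebra p) D₁.X],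
        D₁.IsTorsion ∧ D₁.mu = 0 ∧ r₁ ≤ lambdaInvariant p D₁.X)
    {κ : ZpExtension ℚ p} {γ : absoluteGaloisGroup ℚ}
    (hκ : κ.IsCyclotomic) (hγ : κ.IsTopGenerator γ) (hγ' : IsCyclotomicVariable p γ)
    (D₁ : W₁.SelmerDualData κ γ) [Module.Finite (IwasawaAlgebra p) D₁.X] :
    D₁.IsTorsion ∧ (D₁.mu = 0 → r₁ ≤ lambdaInvariant p D₁.X) := by
  obtain ⟨hX₁, -, hr₁⟩ := h₁ hκ hγ hγ' D₁
  exact ⟨hX₁, fun _ ↦ hr₁⟩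

end Budget

/-! ### §2 An (M) ∧ surj(p) partner supplies the input from Kato's divisibility ALONE -/

section PartnerM

variable {W₁ : WeierstrassCurve ℚ} [W₁.IsElliptic] {p : ℕ} [hp : Fact p.Prime]

/-- **(M) ∧ surj(p) partner, EVERY odd `p`: torsion and `μ = 0 ⟹ r₁ ≤ λ` with NO certificate.** For
`W₁` X4(M) ∧ surj(p), the modular parametrisation (`hmodD`) and Kato's divisibility (`hK`): every
finitely generated cyclotomic dual datum `D₁` of `Sel_{p^∞}(W₁/ℚ_∞)` is TORSION (the brick
`isTorsion_and_exists_iota_eq_of_katoHalf` on the multiplicative twist model, either parity, either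
sign of `a_p(E₁♭)`), and `μ(X₁) = 0 ⟹ r₁ ≤ λ(X₁)` for every `r₁ ≤ rank W₁(ℚ)` (a generator of unit
content by Greenberg–Vatsal (1) ⟺ (2), then `T^{rank} ∣ char`, n1011-p10's
`le_lambdaInvariant_of_le_mordellWeilRank`). Exactly the hypothesis `h₁` of
`budgetLeLambdaAt_of_epw_of_partnerRank`.
[cite: Kato2004Asterisque, Thm. 17.4 (3) (p. 273)] [cite: GreenbergVatsal2000, p. 2, (1)–(2)]
[cite: GreenbergLNM1716, §3 Lemma 3.1 (T^{rank} ∣ char)] -/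
theorem ClassX4M.isTorsion_and_le_lambdaInvariant_of_katoHalf
    (hK : Wuthrich2014.kato_halfEigenCharIdeal_dvd_cyclotomicPrime_of_surjective)
    (hmodD : nonempty_modularParametrizationData)
    (hX₁ : ClassX4M W₁ p) (hsurj₁ : Surj W₁ p) {r₁ : ℕ} (hr₁ : r₁ ≤ W₁.mordellWeilRank)
    {κ : ZpExtension ℚ p} {γ : absoluteGaloisGroup ℚ}
    (hκ : κ.IsCyclotomic) (hγ : κ.IsTopGenerator γ) (hγ' : IsCyclotomicVariable p γ)
    (D₁ : W₁.SelmerDualData κ γ) [Module.Finite (IwasawaAlgebra p) D₁.X] :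
    D₁.IsTorsion ∧ (D₁.mu = 0 → r₁ ≤ lambdaInvariant p D₁.X) := by
  have hp2 : p ≠ 2 := hX₁.p_ne_two
  obtain ⟨V, iV, iVm, C, hV, hC⟩ := hX₁.exists_mult_pStar_twist_model
  haveI : NeZero (V.conductorNorm ℤ) := ⟨(V.conductorNorm_pos_holds).ne'⟩
  obtain ⟨Dm⟩ := hmodD V
  obtain ⟨ϖ, hϖ⟩ := exists_periodRatio_parity (p := p) V Dm
  have hsurjV : ∀ n : ℕ, V.HasSurjectiveModNGaloisRep (p ^ n : ℕ) :=
    (ClassX4M.potMult W₁ p hX₁).towerSurj_twist_of_surj hp2 hsurj₁ V C hC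
  -- torsion from the brick, on the split / non-split multiplicative branch series of `E₁♭`
  have hXt : D₁.IsTorsion := by
    by_cases hs : V.HasSplitMultiplicativeReductionAtPrime p
    · exact (isTorsion_and_exists_iota_eq_of_katoHalf hK hp2 V C hC hsurjV hκ hγ hγ' Dm.isNewformOf D₁
        _ (Or.inr (Or.inl ⟨hs, rfl⟩)) ϖ hϖ).1
    · exact (isTorsion_and_exists_iota_eq_of_katoHalf hK hp2 V C hC hsurjV hκ hγ hγ' Dm.isNewformOf D₁
        _ (Or.inr (Or.inr ⟨hV, hs, rfl⟩)) ϖ hϖ).1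
  refine ⟨hXt, fun hmu ↦ ?_⟩
  obtain ⟨fE₁, hchar, -⟩ := exists_charIdeal_eq_span_singleton p D₁
  have hfE : HasUnitContent fE₁ :=
    (GreenbergVatsal2000.mu_eq_zero_iff_hasUnitContent D₁ hXt hchar).mp hmu
  exact le_lambdaInvariant_of_le_mordellWeilRank hγ D₁ hXt hchar hfE (dvd_refl fE₁) hr₁

end PartnerM

/-! ### §3 The rank-`0` ENDS from the record + EPW + a partner of enough rank -/

section Ends

variable {W W₁ : WeierstrassCurve ℚ} [W.IsElliptic] [W.IsGloballyMinimal] [W₁.IsElliptic]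
  [W₁.IsGloballyMinimal] {p : ℕ} [hp : Fact p.Prime]

/-- **X4(M) ∧ surj(p) ∧ `r_an = 0`, EVERY odd `p` (`p = 3` included): `BSD(E,p)` ⟸ the census record at
index `b` + the CITED EPW transfer + a congruent partner of enough rank.** Inputs: the named facts
`hK, hEPW, hDel, hDelX, hPal (even branch), hGZK, hmod, hmodD`; the record (parity of `(p−1)/2`) at
index `b` (CERTIFICATE-EVIDENCE); the lines `L`, `L₁`, the line-respecting `E[p] ≃ E₁[p]`, `Σ₀` (per
pair); a partner with torsion cyclotomic dual data and `μ = 0 ⟹ r₁ ≤ λ` (§2 for an (M) ∧ surj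
partner); `b ≤ r₁ + Σ_{w∈Σ₀} (δ(E₁,w) − δ(E,w))`. `E[p]` irreducible is READ OFF X4 (`ClassX4M.irr`).
PER PAIR; X4(M) stays CONSTRUCTION-SHAPED; nothing booked.
[cite: Kato2004Asterisque, Thm. 17.4 (3) (p. 273)] [cite: EmertonPollackWeston2006, Thm. 3.3.2, Thm. 3.3.3 (2) (arXiv:math/0404484 p. 19) and Lemma 5.1.5 (p. 30)]
[cite: Delbourgo1998, Prop. 4 (p. 144)] [cite: Pal2012, Thm. 3.2] [cite: Miller2011LMS, Def. 1.1] -/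
theorem ClassX4M.bsdp_rankZero_of_surj_of_katoHalf_of_firstUnitIndex_of_epw
    (hK : Wuthrich2014.kato_halfEigenCharIdeal_dvd_cyclotomicPrime_of_surjective)
    (hEPW : muLambdaAlg_transfer_of_torsionIso_potOrd)
    (hDel : Delbourgo1998.prop4_rankZero_pow_dvd_constantCoeff)
    (hDelX : Delbourgo1998.prop4_rankZero_constantCoeff_eq_unit_mul_of_potMult)
    (hPal : Pal2012.thm32_sqrt_mul_realPeriodRat_twist_eq_of_prime_one_mod_four)
    (hGZK : rank_eq_analyticRank_of_analyticRank_le_one) (hmod : hasEntireLFunction_rat)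
    (hmodD : nonempty_modularParametrizationData)
    (hX : ClassX4M W p) (hsurj : Surj W p) (hr : W.analyticRank = 0) {b : ℕ}
    (hrec : (p % 4 = 1 → MultFirstUnitIndexAt W p b) ∧ (p % 4 = 3 → MultOddFirstUnitIndexAt W p b))
    {v : HeightOneSpectrum (𝓞 ℚ)} (hv : ((p : ℕ) : 𝓞 ℚ) ∈ v.asIdeal)
    {L : LocalDatum ℚ (W.geomPrimaryTorsion p) v} {L₁ : LocalDatum ℚ (W₁.geomPrimaryTorsion p) v}
    (hL : IsRamifiedOrdinaryLine W p L) (hL₁ : IsRamifiedOrdinaryLine W₁ p L₁)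
    (hiso : ∃ e : geomTorsion W (p : ℤ) ≃+ geomTorsion W₁ (p : ℤ),
      (∀ (σ : absoluteGaloisGroup ℚ) (P : geomTorsion W (p : ℤ)), e (σ • P) = σ • e P) ∧
      (∀ P : geomTorsion W (p : ℤ),
        AddSubgroup.inclusion (geomTorsion_le_geomPrimaryTorsion W p) P ∈ L.plus ↔
          AddSubgroup.inclusion (geomTorsion_le_geomPrimaryTorsion W₁ p) (e P) ∈ L₁.plus))
    (S₀ : Finset (HeightOneSpectrum (𝓞 ℚ))) (hS₀ : ∀ w ∈ S₀, ((p : ℕ) : 𝓞 ℚ) ∉ w.asIdeal)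
    (hS : ∀ w : HeightOneSpectrum (𝓞 ℚ), w ∉ S₀ → ((p : ℕ) : 𝓞 ℚ) ∉ w.asIdeal →
      W.HasGoodReductionAt w)
    (hS₁ : ∀ w : HeightOneSpectrum (𝓞 ℚ), w ∉ S₀ → ((p : ℕ) : 𝓞 ℚ) ∉ w.asIdeal →
      W₁.HasGoodReductionAt w)
    {r₁ : ℕ}
    (h₁ : ∀ {κ : ZpExtension ℚ p} {γ : absoluteGaloisGroup ℚ},
      κ.IsCyclotomic → κ.IsTopGenerator γ → IsCyclotomicVariable p γ →
      ∀ (D₁ : W₁.SelmerDualData κ γ) [Module.Finite (IwasawaAlgebra p) D₁.X],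
        D₁.IsTorsion ∧ (D₁.mu = 0 → r₁ ≤ lambdaInvariant p D₁.X))
    (hb : (b : ℤ) ≤ r₁ + ∑ w ∈ S₀, ((delta W₁ p w : ℤ) - (delta W p w : ℤ))) : BSDp W p :=
  hX.bsdp_rankZero_of_surj_of_katoHalf_of_firstUnitIndex_of_budget hK hDel hDelX hPal hGZK hmod hmodD
    hsurj hr hrec
    (budgetLeLambdaAt_of_epw_of_partnerRank hEPW hX.p_ne_two hv hL hL₁ hX.irr hiso S₀ hS₀ hS hS₁ h₁ hb)

/-- **(M)–(M) congruent pair via EPW, fully composed, EVERY odd `p` (`p = 3` included):** `E = W`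
X4(M) ∧ surj(p) ∧ `r_an = 0` with the record at index `b`; partner `E₁ = W₁` X4(M) ∧ surj(p) with
`r₁ ≤ rank E₁(ℚ)` — NO certificate at the partner (§2); lines `L`, `L₁`, line-respecting
`E[p] ≃ E₁[p]`, `Σ₀`; `b ≤ r₁ + Σ_{w∈Σ₀} (δ(E₁,w) − δ(E,w))` ⟹ `BSD(E,p)`. So per (M)–(M) congruent pair
the residual inputs are EXACTLY: ONE unit coefficient at `E` (the record), the two line data + the
isomorphism + `Σ₀`, and a partner of rank `≥ r₁` — the (M) twin of n1011-p10's F4 sentence.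
[cite: Kato2004Asterisque, Thm. 17.4 (3) (p. 273)] [cite: EmertonPollackWeston2006, Thm. 3.3.2, Thm. 3.3.3 (2) (arXiv:math/0404484 p. 19) and Lemma 5.1.5 (p. 30)]
[cite: Delbourgo1998, Prop. 4 (p. 144)] [cite: Pal2012, Thm. 3.2] [cite: Miller2011LMS, Def. 1.1]
[cite: GreenbergLNM1716, §3 Lemma 3.1] -/
theorem ClassX4M.bsdp_rankZero_of_surj_of_katoHalf_of_firstUnitIndex_of_epw_of_multPartner
    (hK : Wuthrich2014.kato_halfEigenCharIdeal_dvd_cyclotomicPrime_of_surjective)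
    (hEPW : muLambdaAlg_transfer_of_torsionIso_potOrd)
    (hDel : Delbourgo1998.prop4_rankZero_pow_dvd_constantCoeff)
    (hDelX : Delbourgo1998.prop4_rankZero_constantCoeff_eq_unit_mul_of_potMult)
    (hPal : Pal2012.thm32_sqrt_mul_realPeriodRat_twist_eq_of_prime_one_mod_four)
    (hGZK : rank_eq_analyticRank_of_analyticRank_le_one) (hmod : hasEntireLFunction_rat)
    (hmodD : nonempty_modularParametrizationData)
    (hX : ClassX4M W p) (hsurj : Surj W p) (hr : W.analyticRank = 0) {b : ℕ}
    (hrec : (p % 4 = 1 → MultFirstUnitIndexAt W p b) ∧ (p % 4 = 3 → MultOddFirstUnitIndexAt W p b))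
    (hX₁ : ClassX4M W₁ p) (hsurj₁ : Surj W₁ p) {r₁ : ℕ} (hr₁ : r₁ ≤ W₁.mordellWeilRank)
    {v : HeightOneSpectrum (𝓞 ℚ)} (hv : ((p : ℕ) : 𝓞 ℚ) ∈ v.asIdeal)
    {L : LocalDatum ℚ (W.geomPrimaryTorsion p) v} {L₁ : LocalDatum ℚ (W₁.geomPrimaryTorsion p) v}
    (hL : IsRamifiedOrdinaryLine W p L) (hL₁ : IsRamifiedOrdinaryLine W₁ p L₁)
    (hiso : ∃ e : geomTorsion W (p : ℤ) ≃+ geomTorsion W₁ (p : ℤ),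
      (∀ (σ : absoluteGaloisGroup ℚ) (P : geomTorsion W (p : ℤ)), e (σ • P) = σ • e P) ∧
      (∀ P : geomTorsion W (p : ℤ),
        AddSubgroup.inclusion (geomTorsion_le_geomPrimaryTorsion W p) P ∈ L.plus ↔
          AddSubgroup.inclusion (geomTorsion_le_geomPrimaryTorsion W₁ p) (e P) ∈ L₁.plus))
    (S₀ : Finset (HeightOneSpectrum (𝓞 ℚ))) (hS₀ : ∀ w ∈ S₀, ((p : ℕ) : 𝓞 ℚ) ∉ w.asIdeal)
    (hS : ∀ w : HeightOneSpectrum (𝓞 ℚ), w ∉ S₀ → ((p : ℕ) : 𝓞 ℚ) ∉ w.asIdeal →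
      W.HasGoodReductionAt w)
    (hS₁ : ∀ w : HeightOneSpectrum (𝓞 ℚ), w ∉ S₀ → ((p : ℕ) : 𝓞 ℚ) ∉ w.asIdeal →
      W₁.HasGoodReductionAt w)
    (hb : (b : ℤ) ≤ r₁ + ∑ w ∈ S₀, ((delta W₁ p w : ℤ) - (delta W p w : ℤ))) : BSDp W p :=
  hX.bsdp_rankZero_of_surj_of_katoHalf_of_firstUnitIndex_of_epw hK hEPW hDel hDelX hPal hGZK hmod hmodD
    hsurj hr hrec hv hL hL₁ hiso S₀ hS₀ hS hS₁
    (fun hκ hγ hγ' D₁ _ ↦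
      hX₁.isTorsion_and_le_lambdaInvariant_of_katoHalf hK hmodD hsurj₁ hr₁ hκ hγ hγ' D₁) hb

/-- **`p = 3` specialisation** (the N11 (M) rows; record on the odd branch `MultOddFirstUnitIndexAt W 3 b`;
at `p = 3` ANY two curves of the def are served by the one EPW fact, n1011-lit C-audit N1): (M)–(M)
congruent pair at `3` ⟹ `BSD(E,3)` from the record at `E`, the line data, and a partner of rank `≥ r₁`.
[cite: Kato2004Asterisque, Thm. 17.4 (3) (p. 273)] [cite: EmertonPollackWeston2006, Thm. 3.3.3 (2) (arXiv:math/0404484 p. 19)]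
[cite: Delbourgo1998, Prop. 4 (p. 144)] [cite: Miller2011LMS, Def. 1.1] -/
theorem ClassX4M.bsdp_three_rankZero_of_surj_of_katoHalf_of_firstUnitIndex_of_epw_of_multPartner
    [Fact (Nat.Prime 3)] {W W₁ : WeierstrassCurve ℚ} [W.IsElliptic] [W.IsGloballyMinimal]
    [W₁.IsElliptic] [W₁.IsGloballyMinimal]
    (hK : Wuthrich2014.kato_halfEigenCharIdeal_dvd_cyclotomicPrime_of_surjective)
    (hEPW : muLambdaAlg_transfer_of_torsionIso_potOrd)
    (hDel : Delbourgo1998.prop4_rankZero_pow_dvd_constantCoeff)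
    (hDelX : Delbourgo1998.prop4_rankZero_constantCoeff_eq_unit_mul_of_potMult)
    (hPal : Pal2012.thm32_sqrt_mul_realPeriodRat_twist_eq_of_prime_one_mod_four)
    (hGZK : rank_eq_analyticRank_of_analyticRank_le_one) (hmod : hasEntireLFunction_rat)
    (hmodD : nonempty_modularParametrizationData)
    (hX : ClassX4M W 3) (hsurj : Surj W 3) (hr : W.analyticRank = 0) {b : ℕ}
    (hrec : MultOddFirstUnitIndexAt W 3 b)
    (hX₁ : ClassX4M W₁ 3) (hsurj₁ : Surj W₁ 3) {r₁ : ℕ} (hr₁ : r₁ ≤ W₁.mordellWeilRank)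
    {v : HeightOneSpectrum (𝓞 ℚ)} (hv : ((3 : ℕ) : 𝓞 ℚ) ∈ v.asIdeal)
    {L : LocalDatum ℚ (W.geomPrimaryTorsion 3) v} {L₁ : LocalDatum ℚ (W₁.geomPrimaryTorsion 3) v}
    (hL : IsRamifiedOrdinaryLine W 3 L) (hL₁ : IsRamifiedOrdinaryLine W₁ 3 L₁)
    (hiso : ∃ e : geomTorsion W ((3 : ℕ) : ℤ) ≃+ geomTorsion W₁ ((3 : ℕ) : ℤ),
      (∀ (σ : absoluteGaloisGroup ℚ) (P : geomTorsion W ((3 : ℕ) : ℤ)), e (σ • P) = σ • e P) ∧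
      (∀ P : geomTorsion W ((3 : ℕ) : ℤ),
        AddSubgroup.inclusion (geomTorsion_le_geomPrimaryTorsion W 3) P ∈ L.plus ↔
          AddSubgroup.inclusion (geomTorsion_le_geomPrimaryTorsion W₁ 3) (e P) ∈ L₁.plus))
    (S₀ : Finset (HeightOneSpectrum (𝓞 ℚ))) (hS₀ : ∀ w ∈ S₀, ((3 : ℕ) : 𝓞 ℚ) ∉ w.asIdeal)
    (hS : ∀ w : HeightOneSpectrum (𝓞 ℚ), w ∉ S₀ → ((3 : ℕ) : 𝓞 ℚ) ∉ w.asIdeal →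
      W.HasGoodReductionAt w)
    (hS₁ : ∀ w : HeightOneSpectrum (𝓞 ℚ), w ∉ S₀ → ((3 : ℕ) : 𝓞 ℚ) ∉ w.asIdeal →
      W₁.HasGoodReductionAt w)
    (hb : (b : ℤ) ≤ r₁ + ∑ w ∈ S₀, ((delta W₁ 3 w : ℤ) - (delta W 3 w : ℤ))) : BSDp W 3 :=
  hX.bsdp_rankZero_of_surj_of_katoHalf_of_firstUnitIndex_of_epw_of_multPartner hK hEPW hDel hDelX hPal
    hGZK hmod hmodD hsurj hr ⟨fun h ↦ absurd h (by norm_num), fun _ ↦ hrec⟩ hX₁ hsurj₁ hr₁ hv hL hL₁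
    hiso S₀ hS₀ hS hS₁ hb

end Ends

end Summit.BirchSwinnertonDyer.Rank1Residual.AdditivePotMult

end
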